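import Summits.QuantumFields.BalabanUV.T4Continuum.Support.NE7MinimiserC1Flat
import Summits.QuantumFields.BalabanUV.T4Continuum.Support.NE7GaugeActChartTransferL
import HarnessLib

/-!
# NE7MinimiserC1FlatOrbit — `U_k(V)` IS `C¹` IN THE DATUM NEAR EVERY PURE-GAUGE DATUM `w·1` (ROAD-G114 §11 (i)): the flat theorem ✓ p826121 transported along the gauge orbit of the flat
# datum by COVARIANCE — a unitary `N`-periodic coarse gauge `w` has the block-constant fine extension `u` (corners `w`), `U ↦ u·U` maps minimisers over `D` to minimisers over `w·D` with the
# same level action, and `chart_{w·1} y = w·chart_1(J y)`, `u·chart_1 Φ = chart_{u·1}(J′ Φ)` with continuous LINEAR `J, J′` (✓ `gaugeAct_chart_transferL`); so over the datum `chart_{w·1} y` the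
# configuration `chart_{u·1}(J′(Ψ(J y)))` is a minimiser, `C¹` in `y`, and `y ↦ minAct(chart_{w·1} y) = minAct(chart_1(J y))` is `C¹` at `0`.  No genericity hypothesis

Cell `pub-balaban`, rung (B)+1 sub-cell t4, lineage `b2b-balaban-t4-ne7-p1` (CRUX PROVER NE7 #1 = OWNER of BINDER row NE7), generation 114.  Memo `t4/b2b-balaban-t4-ne7-p1-g114/ROAD-G114.md` §11.
WHAT ([folklore]; 0 def, 0 sorry; `d = 4`, every `U(n)`, `L ≥ 2`).  **`minimiser_contDiffAt_flatOrbit`**.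
HONEST FRAMING (page 1): composition of landed kernel theorems; radii existential; `C¹` only; nothing of Bałaban's asserted; NOT NE7 as a spine node, NOT NE3; spine 0∕9; finite T⁴ rung
(B)+1 — NOT infinite volume, NOT mass gap, NOT BetaPertH, NOT Clay.
-/

set_option autoImplicit false

open scoped BigOperators Matrix Matrix.Norms.L2Operator Topology
open NormedSpace Finset Set Filter Metric

namespace Summit.QuantumFields.BalabanUV.T4Continuum.NE7MinimiserC1FlatOrbit

open Literature.MathematicalPhysics.QuantumFieldTheory.Balaban1983to89
open B7Prop1Explicit B7Prop2Explicit
open T4AveragingDeficitWall (IsUnitaryCfg SmallField)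
open T4AveragingDeficitWallBoundary (IsPeriodicCfg)
open AveragingDeficitTorusChart (TDir chart redN)
open AveragingDeficitTwoLevelPrep (skewSub)
open AveragingDeficitMultiLevelPrep (tower tower_ne_zero)
open MinimalActionSandwich (IsMinimiser minAct) open MinimalActionRate (sfClass)
open NE3EnergyShapes (IsUnitarySite IsPeriodicSite gaugeAct_one)
open MinimalActionWitness (flatCfg isMinimiser_sfClass_flatCfg)
open NE7MinimalOrbitDatumContinuity (thresholds)
open NE7EtaMinimiserGaugeCovariance (isMinimiser_gaugeAct levelAction_gaugeAct)
open NE7MinimiserLipschitzPrep (gaugeAct_mul_fun blockConst_corner blockConst_periodic)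
open NE7AdmissibleFibreLHC (period_succ_eq)
open NE7MinimiserC1Flat (minimiser_contDiffAt_flat)
open NE7GaugeActChartTransferL (gaugeAct_chart_transferL)

noncomputable section

variable {n : Type} [Fintype n] [DecidableEq n]

set_option maxHeartbeats 1600000 in
/-- **`U_k(V)` IS `C¹` IN `V` NEAR EVERY PURE-GAUGE DATUM `w·1`, AND SO IS THE MINIMAL ACTION** (see the module docstring). [folklore] -/
theorem minimiser_contDiffAt_flatOrbit [Nonempty n] {L : ℕ} [NeZero L] (hL : 2 ≤ L) :
    ∃ ε₀ : ℝ, 0 < ε₀ ∧ ∀ ε : ℝ, 0 < ε → ε ≤ ε₀ → ∀ (N : ℕ) [NeZero N], 1 ≤ N → ∀ j : ℕ,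
      ∀ w : Site 4 → (Matrix n n ℂ)ˣ, IsUnitarySite w → IsPeriodicSite w (N : ℤ) →
      ∃ (U₀ : Site 4 → Fin 4 → (Matrix n n ℂ)ˣ) (Ψ : ↥(skewSub 4 n N) → ↥(skewSub 4 n (L * tower L N j))),
        IsMinimiser 4 (sfClass 4 L N ε) L N (j + 1) (gaugeAct w flatCfg) U₀ ∧ ContDiffAt ℝ 1 Ψ 0 ∧ Ψ 0 = 0 ∧
        (∀ᶠ y : ↥(skewSub 4 n N) in 𝓝 0, IsMinimiser 4 (sfClass 4 L N ε) L N (j + 1)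
          (chart (ContinuousLinearMap.id ℝ (Matrix n n ℂ)) N (gaugeAct w flatCfg) (y : TDir 4 n N))
          (chart (ContinuousLinearMap.id ℝ (Matrix n n ℂ)) (L * tower L N j) U₀ ((Ψ y : ↥(skewSub 4 n (L * tower L N j))) : TDir 4 n (L * tower L N j)))) ∧
        ContDiffAt ℝ 1 (fun y : ↥(skewSub 4 n N) => minAct 4 (sfClass 4 L N ε) L N (j + 1)
          (chart (ContinuousLinearMap.id ℝ (Matrix n n ℂ)) N (gaugeAct w flatCfg) (y : TDir 4 n N))) 0 := by
  have hL1 : 1 ≤ L := by omega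
  obtain ⟨ε₁, hε₁, H⟩ := thresholds (n := n) hL
  obtain ⟨ε₂, hε₂, H2⟩ := minimiser_contDiffAt_flat (n := n) hL
  refine ⟨min ε₁ ε₂, lt_min hε₁ hε₂, fun ε hε hεle N _ hN j w hwu hwP => ?_⟩
  obtain ⟨-, -, hls, -⟩ := H ε hε (hεle.trans (min_le_left _ _))
  obtain ⟨Ψ₁, hΨ₁c, hΨ₁0, hmin₁, hC1₁⟩ := H2 ε hε (hεle.trans (min_le_right _ _)) N hN j
  haveI : NeZero (L * tower L N j) := ⟨Nat.mul_ne_zero (NeZero.ne L) (tower_ne_zero L N j)⟩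
  have hper : N * L ^ (j + 1) = L * tower L N j := period_succ_eq L N j
  have hLj : 1 ≤ L ^ (j + 1) := Nat.one_le_pow _ _ (by omega)
  -- the block-constant fine extension `u` of `w` and the base minimiser `U₀ = u·1` over `w·1`
  set u : Site 4 → (Matrix n n ℂ)ˣ := fun x => w (fun i => x i / ((L ^ (j + 1) : ℕ) : ℤ)) with hu
  have huu : IsUnitarySite u := fun x => hwu _
  have huP : IsPeriodicSite u ((N * L ^ (j + 1) : ℕ) : ℤ) := fun x i => blockConst_periodic hLj hwP x i
  have huPM : IsPeriodicSite u ((L * tower L N j : ℕ) : ℤ) := by have h := huP; rwa [hper] at h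
  have huc : (fun z : Site 4 => u (((L : ℤ) ^ (j + 1)) • z)) = w := by
    funext z; have h := blockConst_corner w hLj z; simp only [Nat.cast_pow] at h; exact h
  set U₀ : Site 4 → Fin 4 → (Matrix n n ℂ)ˣ := gaugeAct u flatCfg with hU₀
  have hU₀ : IsMinimiser 4 (sfClass 4 L N ε) L N (j + 1) (gaugeAct w flatCfg) U₀ := by
    have h := isMinimiser_gaugeAct hL1 hε.le j (hls j) (isMinimiser_sfClass_flatCfg (d := 4) (n := n) hL1 N hε.le (j + 1)) huu huP
    rwa [huc] at h
  -- the coarse transfer `chart_{w·1} y = w·chart_1(J y)` and the fine transfer `u·chart_1 Φ = chart_{U₀}(J′ Φ)`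
  have hwiu : IsUnitarySite (fun z : Site 4 => (w z)⁻¹) := fun z => (unitaryUnits _).inv_mem (hwu z)
  have hwiP : IsPeriodicSite (fun z : Site 4 => (w z)⁻¹) (N : ℤ) := fun z i => by simp only [hwP z i]
  obtain ⟨J, hJ⟩ := gaugeAct_chart_transferL (M := N) hwiu hwiP (gaugeAct w (flatCfg : Site 4 → Fin 4 → (Matrix n n ℂ)ˣ))
  have hDy : ∀ y : ↥(skewSub 4 n N), chart (ContinuousLinearMap.id ℝ (Matrix n n ℂ)) N (gaugeAct w flatCfg) (y : TDir 4 n N)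
      = gaugeAct w (chart (ContinuousLinearMap.id ℝ (Matrix n n ℂ)) N (flatCfg : Site 4 → Fin 4 → (Matrix n n ℂ)ˣ) ((J y : ↥(skewSub 4 n N)) : TDir 4 n N)) := by
    intro y
    have h := (hJ y).1
    rw [AveragingDeficitKDatum.gaugeAct_inv_gaugeAct] at h
    have h2 := congrArg (gaugeAct w) h
    rw [← gaugeAct_mul_fun] at h2
    have e : (fun x : Site 4 => w x * (w x)⁻¹) = fun _ => (1 : (Matrix n n ℂ)ˣ) := by funext x; rw [mul_inv_cancel]
    rw [e, gaugeAct_one] at h2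
    exact h2
  obtain ⟨J', hJ'⟩ := gaugeAct_chart_transferL (M := L * tower L N j) huu huPM (flatCfg : Site 4 → Fin 4 → (Matrix n n ℂ)ˣ)
  -- the section
  set Ψ : ↥(skewSub 4 n N) → ↥(skewSub 4 n (L * tower L N j)) := fun y => J' (Ψ₁ (J y)) with hΨ
  have hJ0 : J 0 = 0 := map_zero J
  have hΨc : ContDiffAt ℝ 1 Ψ 0 := by
    have h1 : ContDiffAt ℝ 1 Ψ₁ (J 0) := by rw [hJ0]; exact hΨ₁c
    exact J'.contDiff.contDiffAt.comp 0 (h1.comp 0 J.contDiff.contDiffAt)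
  have hΨ0 : Ψ 0 = 0 := by simp only [hΨ, hJ0, hΨ₁0, map_zero]
  have htJ : Tendsto (fun y : ↥(skewSub 4 n N) => J y) (𝓝 0) (𝓝 0) := by
    have h := J.continuous.tendsto 0; rwa [hJ0] at h
  have hkey : ∀ᶠ y : ↥(skewSub 4 n N) in 𝓝 0, IsMinimiser 4 (sfClass 4 L N ε) L N (j + 1)
      (chart (ContinuousLinearMap.id ℝ (Matrix n n ℂ)) N (gaugeAct w flatCfg) (y : TDir 4 n N))
      (chart (ContinuousLinearMap.id ℝ (Matrix n n ℂ)) (L * tower L N j) U₀ ((Ψ y : ↥(skewSub 4 n (L * tower L N j))) : TDir 4 n (L * tower L N j))) ∧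
      minAct 4 (sfClass 4 L N ε) L N (j + 1) (chart (ContinuousLinearMap.id ℝ (Matrix n n ℂ)) N (gaugeAct w flatCfg) (y : TDir 4 n N))
        = minAct 4 (sfClass 4 L N ε) L N (j + 1) (chart (ContinuousLinearMap.id ℝ (Matrix n n ℂ)) N (flatCfg : Site 4 → Fin 4 → (Matrix n n ℂ)ˣ) ((J y : ↥(skewSub 4 n N)) : TDir 4 n N)) := by
    filter_upwards [htJ.eventually hmin₁] with y hy
    have h := isMinimiser_gaugeAct hL1 hε.le j (hls j) hy huu huP
    rw [huc, ← hDy y, (hJ' (Ψ₁ (J y))).1] at h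
    refine ⟨h, ?_⟩
    rw [h.minAct_eq, hy.minAct_eq, ← (hJ' (Ψ₁ (J y))).1, levelAction_gaugeAct]
  refine ⟨U₀, Ψ, hU₀, hΨc, hΨ0, hkey.mono fun y hy => hy.1, ?_⟩
  have hg : ContDiffAt ℝ 1 (fun y : ↥(skewSub 4 n N) => minAct 4 (sfClass 4 L N ε) L N (j + 1)
      (chart (ContinuousLinearMap.id ℝ (Matrix n n ℂ)) N (flatCfg : Site 4 → Fin 4 → (Matrix n n ℂ)ˣ) ((J y : ↥(skewSub 4 n N)) : TDir 4 n N))) 0 := by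
    have h1 : ContDiffAt ℝ 1 (fun y : ↥(skewSub 4 n N) => minAct 4 (sfClass 4 L N ε) L N (j + 1)
        (chart (ContinuousLinearMap.id ℝ (Matrix n n ℂ)) N (flatCfg : Site 4 → Fin 4 → (Matrix n n ℂ)ˣ) (y : TDir 4 n N))) (J 0) := by rw [hJ0]; exact hC1₁
    exact h1.comp 0 J.contDiff.contDiffAt
  exact hg.congr_of_eventuallyEq (hkey.mono fun y hy => hy.2)

end

end Summit.QuantumFields.BalabanUV.T4Continuum.NE7MinimiserC1FlatOrbit
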